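import Mathlib
import Summits.HodgeConjecture.FermatCycles.HodgeFermatFiveZ3Z1
import Summits.HodgeConjecture.FermatCycles.HodgeFermatCorollaryMFinal
import Summits.HodgeConjecture.FermatCycles.HodgeFermatThreeShared

/-!
# COROLLARY M, final form: no Z3 at 5 (`HodgeFermat/FiveFinal.lean`; HF-G30) and the clause at 3 — "m ≠ 21 ⟹ neither triple is Z3 at 3" (`ThreeFinal.lean`; HF-G30b)

Tree copy of 2 SMALL MODULES of the sibling cell's standalone package `run/shared/lean/pub/pub-hodgefermat/lean/HodgeFermat/`,
concatenated IN DEPENDENCY ORDER in one tree file (one gate round-trip instead of 2; the hub's import-level build backlog was ≈ 50 min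
per level when this file was assembled) — each module's body byte-identical to its source lines, its own `namespace … end` block kept:
  1. `HodgeFermat/FiveFinal.lean` (118 lines, sha256 `fb04281d30e431bc…`), whole module, source lines 28–118 (all: `no_Z3_left`, `five_noZ3`, `five_clause_final`, `corollaryM_final`) — pub-hodgefermat `CERT.md` l.957, GATE HF-G30; cell record `check/FiveFinal_standalone.lean` sha256 `fdf2c62a2be711be…`;
  2. `HodgeFermat/ThreeFinal.lean` (114 lines, sha256 `a62dbb7fa3b90adb…`), whole module, source lines 24–114 (all: `no_Z3_at_three`, `corollaryM_final` — COROLLARY M with the clause at 3) — pub-hodgefermat `CERT.md` l.960, GATE HF-G30b; cell record `check/ThreeFinal_standalone.lean` sha256 `9a67d1260b07766e…`;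
Filed by cell `pub-hfermat`, seat prover-1 gen-3, on the COORDINATOR KEEPER RULING of 2026-08-25 (gem sweep H1: take the
off-gate kernel theorem `thmFstar` through the gate) — here THEOREM F* of `tables/DPRIME-THEOREM.md` §9 IN FULL, i.e.
PROPOSITION D′(3N) and the descent (`HodgeFermat/PropDPrimeNFinal.lean`, GATE HF-G34), the last off-gate form of THEOREM F*
(its first two forms, `DecodingFinal.thmFstar` = F* at the prime levels and `ThmFstarNFinal.thmFstar` = F*(3N), landed on
2026-08-25 as `HodgeFermatThmFstar.lean` / `HodgeFermatThmFstarN.lean`, seats prover-1 gen-0 / gen-2); these modules are links of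
the import closure of `PropDPrimeNFinal.propDprime` (the sibling's KR-free chain: THEOREM L, COROLLARY M, THEOREM D6,
THEOREM U⁺, THEOREM KR6, THEOREM Z3U) on top of those landed chains.  Each source module is the sibling's module of record named in item 1–2 above; declarations are copied VERBATIM.
Deviations from the source modules, exhaustively: the `import` lines (tree modules `Summits.HodgeConjecture.FermatCycles.HodgeFermat*`
instead of `HodgeFermat.*`, hoisted to the top; the source `import` lines between the concatenated modules are dropped); this docstring
(replacing the modules' docstrings, all quoted below); none at file level beyond the concatenation itself; per module: (`import …HodgeFermatCorollaryMFinal` stands for `FiveFinal`'s `import HodgeFermat.CorollaryMThree`; `ThreeFinal`'s `import HodgeFermat.FiveFinal` points inside this file)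
  — module 1 (`FiveFinal.lean`): the source's `open HodgeFermat.KRFree.RowsFinal (st_symm st_trans normalise)` (l.35) becomes `open HodgeFermat.KRFree.RowsFinal (normalise)` + `open HodgeFermat.KRFree.Decoding (st_symm st_trans)` (restated copies deleted in `HodgeFermatRowsFinal.lean`).
  — module 2 (`ThreeFinal.lean`): the source's `open HodgeFermat.KRFree.RowsFinal (st_symm st_trans normalise)` (l.31) becomes `open HodgeFermat.KRFree.RowsFinal (normalise)` + `open HodgeFermat.KRFree.Decoding (st_symm st_trans)` (restated copies deleted in `HodgeFermatRowsFinal.lean`).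
Every other line — in particular every declaration's statement and proof — is byte-identical to its source.
HONEST FRAMING: explicit algebraic cycles for specific Hodge classes on Fermat/Delsarte varieties; residual open instances
listed; no claim on general Hodge.  (This file is arithmetic of CM types / finite combinatorics / analytic number theory
of the sibling's KR-free programme; it claims nothing about cycles.)

(1) The docstring of `HodgeFermat/FiveFinal.lean` (l.4–26), verbatim:

## HodgeFermat/FiveFinal.lean — generation 30 (HF-G30) of the hodge-fermat build

THEOREM L, ROW p = 5, AND COROLLARY M'S CLAUSE AT 5 IN FINAL FORM AT SQUAREFREE LEVELS: NEITHER TRIPLE IS Z3 AT 5.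
With `FiveZ3Z1.z3z1_five` (the row (Z3, Z1) at 5 is EMPTY at squarefree odd levels) and `TheoremL.row_Z3U` ((Z3, U) is
empty at every p ≥ 5, generation 20/21), the alternative "3 ∣ n and a 5-divisible entry ≡ ± m/3" of
`RowsFinal.five_pattern` (THEOREM L, row p = 5, generation 29) and of `CorollaryMRows.five_clause` /
`CorollaryMThree.corollaryM_final` (COROLLARY M, clause at 5) disappears when the level is squarefree:

* `no_Z3_left` — a triple `(5a₀, 5b₀, 5c₀)` (Z3 at 5) has the CM type of no admissible triple `T′` of level `5n` (zero sum,
  no entry ≡ 0) that is not itself Z3 at 5 (`n` squarefree odd, `5 ∤ n`);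
* `five_noZ3` — **THEOREM L, row p = 5, final form (squarefree odd n, 5 ∤ n)**: two admissible triples of level `5n`, not all
  six entries divisible by 5 (joint primitivity at 5), with the same CM type: NEITHER is Z3 at 5 — the pattern at 5 is
  (U, U), (U, Z1) or (Z1, Z1) (all three occur: `results/gen29/local/rowsfinal_scan_699.txt`);
* `five_clause_final` — **COROLLARY M, clause at 5, final form**: at a squarefree odd level `m` with `5 ∣ m`, for a jointly
  primitive coincidence of CM types neither triple is Z3 at 5 (disjointness not needed);
* `corollaryM_final` — **COROLLARY M in final form, generation 30** (hypotheses THEOREM KR6 `KR6'` and THEOREM U⁺ `ThmUPlus'`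
  only, as in `CorollaryMThree.corollaryM_final`): `3 ∣ m`; (U, U) at every prime `q ≥ 7`; `gcd(x, m) ∣ 15`; `5 ∤ m` and all
  entries prime to 3 ⟹ `m ∈ {21, 39}`; `5 ∣ m ⟹ neither triple Z3 at 5` (sharpened); `m ≠ 21 ⟹` not (Z3, U) at 3.

LIGHT module (imports `FiveZ3Z1`, `CorollaryMThree`).  No `sorry`, no new `decide`, no axiom beyond
[propext, Classical.choice, Quot.sound].

(2) The docstring of `HodgeFermat/ThreeFinal.lean` (l.4–22), verbatim:

## HodgeFermat/ThreeFinal.lean — generation 30 (HF-G30b) of the hodge-fermat build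

COROLLARY M'S CLAUSE AT 3 IN FINAL FORM FOR DISJOINT COINCIDENCES: `m ≠ 21 ⟹` NEITHER TRIPLE IS Z3 AT 3.
`ThreeShared.three_shared` (forced sharing in the row (Z3, Z1) at 3, under THEOREM KR6) says that a Z3-at-3 triple and a
Z1-at-3 triple of the same CM type at a squarefree odd level `3n` share the Z1-entry modulo `3n`; for a DISJOINT
coincidence this row is therefore empty, and with `(Z3, U) at 3 ⟹ m = 21` (`CorollaryMThree.corollaryM_final`, last clause)
and joint primitivity (not (Z3, Z3)) no triple of a disjoint jointly primitive coincidence at a squarefree odd level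
`m ≠ 21` is Z3 at 3:

* `no_Z3_at_three` — level `3n` (`n` squarefree odd, `3 ∤ n`): a Z3-at-3 triple against a disjoint admissible triple that is
  neither U nor Z3 at 3 — impossible (under `KR6'`);
* `corollaryM_final` — **COROLLARY M IN FINAL FORM, generation 30, HF-G30b**: as `FiveFinal.corollaryM_final` with its last clause
  sharpened from "not (Z3, U) at 3" to "neither triple Z3 at 3" (`m ≠ 21`).  Consequently, at `m ∉ {21}` both triples of a
  disjoint jointly primitive coincidence have at most one entry divisible by 3 and (if `5 ∣ m`) at most one divisible by 5.

LIGHT module (imports `FiveFinal`, `ThreeShared`).  No `sorry`, no new `decide`, no axiom beyond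
[propext, Classical.choice, Quot.sound].
-/

/-! ## (1/2) `HodgeFermat/FiveFinal.lean` — source lines 28–118 -/

set_option autoImplicit false

namespace HodgeFermat.KRFree.FiveFinal

open HodgeFermat.KRFree.LemmaN HodgeFermat.KRFree.TheoremL
open HodgeFermat.KRFree.TheoremUEq (ThmUPlus')
open HodgeFermat.KRFree.TheoremZ3U (KR6')
open HodgeFermat.KRFree.RowsFinal (normalise)
open HodgeFermat.KRFree.Decoding (st_symm st_trans)
open HodgeFermat.KRFree.FiveZ3Z1 (z3z1_five)

/-- a Z3-at-5 triple `(5a₀, 5b₀, 5c₀)` against an admissible triple `T′ = (a′, b′, c′)` of level `5n` (zero sum, no entry ≡ 0)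
that is not Z3 at 5: impossible at squarefree odd `n`, `5 ∤ n` — `T′` is U at 5 (`TheoremL.row_Z3U`) or, after the normalising
permutation `RowsFinal.normalise`, Z1 at 5 with its 5-divisible entry in front (`FiveZ3Z1.z3z1_five`). -/
lemma no_Z3_left {n a₀ b₀ c₀ a' b' c' : ℕ} (hsq : Squarefree n) (h5n : ¬ 5 ∣ n) (hodd : Odd n)
    (hs' : 5 * n ∣ a' + b' + c') (ha' : ¬ 5 * n ∣ a') (hb' : ¬ 5 * n ∣ b') (hc' : ¬ 5 * n ∣ c')
    (hnz : ¬ (5 ∣ a' ∧ 5 ∣ b' ∧ 5 ∣ c'))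
    (hH : SameType (5 * n) (5 * a₀, 5 * b₀, 5 * c₀) (a', b', c')) : False := by
  have hn : 0 < n := hodd.pos
  have hN : 0 < 5 * n := by omega
  obtain ⟨a₂, b₂, c₂, -, hS, hs₂, ha₂, -, -, hz₂, hp₂⟩ :=
    normalise (p := 5) hN (dvd_mul_right 5 n) hs' ha' hb' hc'
  have hH₂ : SameType (5 * n) (5 * a₀, 5 * b₀, 5 * c₀) (a₂, b₂, c₂) := st_trans hH (st_symm hS)
  rcases hp₂ with hU | hZ1 | hZ3
  · exact row_Z3U 5 n a₀ b₀ c₀ a₂ b₂ c₂ (by norm_num) le_rfl h5n hn hs₂ hU.1 hU.2.1 hU.2.2 hH₂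
  · obtain ⟨⟨y, rfl⟩, hb₂, hc₂⟩ := hZ1
    exact z3z1_five n a₀ b₀ c₀ y b₂ c₂ hsq h5n hodd hs₂ hb₂ hc₂ (fun h => ha₂ (Nat.mul_dvd_mul_left 5 h))
      (st_symm hH₂)
  · exact hnz (hz₂ 5 hZ3.1 hZ3.2.1 hZ3.2.2)

/-- **THEOREM L, row p = 5, FINAL FORM (squarefree odd `n`, `5 ∤ n`): NEITHER TRIPLE IS Z3 AT 5.**  Two zero-sum triples of
level `m = 5n` with no entry `≡ 0 (mod m)`, not all six entries divisible by 5, of the same CM type: neither has all its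
entries divisible by 5 — the pattern at 5 is (U, U), (U, Z1) or (Z1, Z1).  [`RowsFinal.five_pattern` (every odd n) with
its alternative "(Z3, Z1), x₁′ ≡ ± m/3" removed by `FiveZ3Z1.z3z1_five` (squarefree n).] -/
theorem five_noZ3 (n a b c a' b' c' : ℕ) (hsq : Squarefree n) (h5n : ¬ 5 ∣ n) (hodd : Odd n)
    (hs : 5 * n ∣ a + b + c) (ha : ¬ 5 * n ∣ a) (hb : ¬ 5 * n ∣ b) (hc : ¬ 5 * n ∣ c)
    (hs' : 5 * n ∣ a' + b' + c') (ha' : ¬ 5 * n ∣ a') (hb' : ¬ 5 * n ∣ b') (hc' : ¬ 5 * n ∣ c')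
    (hJP : ¬ (5 ∣ a ∧ 5 ∣ b ∧ 5 ∣ c ∧ 5 ∣ a' ∧ 5 ∣ b' ∧ 5 ∣ c'))
    (hH : SameType (5 * n) (a, b, c) (a', b', c')) :
    ¬ (5 ∣ a ∧ 5 ∣ b ∧ 5 ∣ c) ∧ ¬ (5 ∣ a' ∧ 5 ∣ b' ∧ 5 ∣ c') := by
  refine ⟨fun hZ => ?_, fun hZ' => ?_⟩
  · obtain ⟨⟨a₀, rfl⟩, ⟨b₀, rfl⟩, ⟨c₀, rfl⟩⟩ := hZ
    exact no_Z3_left hsq h5n hodd hs' ha' hb' hc'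
      (fun h => hJP ⟨dvd_mul_right 5 a₀, dvd_mul_right 5 b₀, dvd_mul_right 5 c₀, h⟩) hH
  · obtain ⟨⟨a₀, rfl⟩, ⟨b₀, rfl⟩, ⟨c₀, rfl⟩⟩ := hZ'
    exact no_Z3_left hsq h5n hodd hs ha hb hc
      (fun h => hJP ⟨h.1, h.2.1, h.2.2, dvd_mul_right 5 a₀, dvd_mul_right 5 b₀, dvd_mul_right 5 c₀⟩) (st_symm hH)

/-- **COROLLARY M, clause at 5, FINAL FORM**: at a squarefree odd level `m` with `5 ∣ m`, for a jointly primitive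
coincidence of CM types `(a, b, c) ∼ (a′, b′, c′)` (zero sums, no entry `≡ 0 (mod m)`) NEITHER triple is Z3 at 5 — the
pattern at 5 is (U, U), (U, Z1) or (Z1, Z1).  [`CorollaryMRows.five_clause` without its exceptional case.] -/
theorem five_clause_final (m a b c a' b' c' : ℕ) (hsq : Squarefree m) (hodd : Odd m)
    (hs : m ∣ a + b + c) (ha : ¬ m ∣ a) (hb : ¬ m ∣ b) (hc : ¬ m ∣ c)
    (hs' : m ∣ a' + b' + c') (ha' : ¬ m ∣ a') (hb' : ¬ m ∣ b') (hc' : ¬ m ∣ c')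
    (hJ : ∀ q, Nat.Prime q → q ∣ m → q ∣ a → q ∣ b → q ∣ c → q ∣ a' → q ∣ b' → q ∣ c' → False)
    (hH : SameType m (a, b, c) (a', b', c'))
    (h5 : 5 ∣ m) :
    ¬ (5 ∣ a ∧ 5 ∣ b ∧ 5 ∣ c) ∧ ¬ (5 ∣ a' ∧ 5 ∣ b' ∧ 5 ∣ c') := by
  obtain ⟨n, rfl⟩ := h5
  have h5n : ¬ 5 ∣ n := fun h =>
    (by norm_num : (5:ℕ) ≠ 1) (Nat.isUnit_iff.mp (hsq 5 (Nat.mul_dvd_mul_left 5 h)))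
  have hoddn : Odd n := (Nat.odd_mul.mp hodd).2
  have hsqn : Squarefree n := hsq.of_mul_right
  have hJP : ¬ (5 ∣ a ∧ 5 ∣ b ∧ 5 ∣ c ∧ 5 ∣ a' ∧ 5 ∣ b' ∧ 5 ∣ c') := fun h =>
    hJ 5 Nat.prime_five (dvd_mul_right 5 n) h.1 h.2.1 h.2.2.1 h.2.2.2.1 h.2.2.2.2.1 h.2.2.2.2.2
  exact five_noZ3 n a b c a' b' c' hsqn h5n hoddn hs ha hb hc hs' ha' hb' hc' hJP hH

/-- **COROLLARY M IN FINAL FORM, generation 30** (hypotheses THEOREM KR6 `KR6'` and THEOREM U⁺ `ThmUPlus'` only): for a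
DISJOINT JOINTLY PRIMITIVE coincidence of CM types `(a, b, c) ∼ (a′, b′, c′)` at a squarefree odd level `m` — `3 ∣ m`; every
prime `q ≥ 7` of `m` divides no entry; every entry `x` has `gcd(x, m) ∣ 15`; if `5 ∤ m` and all entries are prime to `3`
then `m ∈ {21, 39}`; if `5 ∣ m`, NEITHER triple is Z3 at 5 (generation 30: the case "some 5-divisible entry ≡ ± m/3" of
`CorollaryMThree.corollaryM_final` does not occur); if `m ≠ 21`, the pattern at `3` is not (Z3, U). -/
theorem corollaryM_final (hKR : KR6') (hUplus : ThmUPlus') (m a b c a' b' c' : ℕ)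
    (hsq : Squarefree m) (hodd : Odd m)
    (hs : m ∣ a + b + c) (ha : ¬ m ∣ a) (hb : ¬ m ∣ b) (hc : ¬ m ∣ c)
    (hs' : m ∣ a' + b' + c') (ha' : ¬ m ∣ a') (hb' : ¬ m ∣ b') (hc' : ¬ m ∣ c')
    (hJ : ∀ q, Nat.Prime q → q ∣ m → q ∣ a → q ∣ b → q ∣ c → q ∣ a' → q ∣ b' → q ∣ c' → False)
    (hD : ∀ u v, (u = a ∨ u = b ∨ u = c) → (v = a' ∨ v = b' ∨ v = c') → ¬ u ≡ v [MOD m])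
    (hH : SameType m (a, b, c) (a', b', c')) :
    3 ∣ m ∧
    (∀ q, Nat.Prime q → 7 ≤ q → q ∣ m → ¬ q ∣ a ∧ ¬ q ∣ b ∧ ¬ q ∣ c ∧ ¬ q ∣ a' ∧ ¬ q ∣ b' ∧ ¬ q ∣ c') ∧
    (∀ x, (x = a ∨ x = b ∨ x = c ∨ x = a' ∨ x = b' ∨ x = c') → Nat.gcd x m ∣ 15) ∧
    (¬ 5 ∣ m → (¬ 3 ∣ a ∧ ¬ 3 ∣ b ∧ ¬ 3 ∣ c ∧ ¬ 3 ∣ a' ∧ ¬ 3 ∣ b' ∧ ¬ 3 ∣ c') → m = 21 ∨ m = 39) ∧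
    (5 ∣ m → ¬ (5 ∣ a ∧ 5 ∣ b ∧ 5 ∣ c) ∧ ¬ (5 ∣ a' ∧ 5 ∣ b' ∧ 5 ∣ c')) ∧
    (m ≠ 21 → ¬ (3 ∣ a ∧ 3 ∣ b ∧ 3 ∣ c ∧ ¬ 3 ∣ a' ∧ ¬ 3 ∣ b' ∧ ¬ 3 ∣ c') ∧
      ¬ (3 ∣ a' ∧ 3 ∣ b' ∧ 3 ∣ c' ∧ ¬ 3 ∣ a ∧ ¬ 3 ∣ b ∧ ¬ 3 ∣ c)) := by
  obtain ⟨h3, h₁, h₂, h₄, -, h₆⟩ := CorollaryMThree.corollaryM_final hKR hUplus m a b c a' b' c' hsq hodd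
    hs ha hb hc hs' ha' hb' hc' hJ hD hH
  exact ⟨h3, h₁, h₂, h₄,
    fun h5 => five_clause_final m a b c a' b' c' hsq hodd hs ha hb hc hs' ha' hb' hc' hJ hH h5, h₆⟩

end HodgeFermat.KRFree.FiveFinal

/-! ## (2/2) `HodgeFermat/ThreeFinal.lean` — source lines 24–114 -/

set_option autoImplicit false

namespace HodgeFermat.KRFree.ThreeFinal

open HodgeFermat.KRFree.LemmaN HodgeFermat.KRFree.TheoremL
open HodgeFermat.KRFree.TheoremUEq (ThmUPlus')
open HodgeFermat.KRFree.TheoremZ3U (KR6')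
open HodgeFermat.KRFree.RowsFinal (normalise)
open HodgeFermat.KRFree.Decoding (st_symm st_trans)
open HodgeFermat.KRFree.ThreeShared (three_shared)

/-- level `3n`, `n` squarefree odd, `3 ∤ n`: a Z3-at-3 triple `(3a₀, 3b₀, 3c₀)` (zero sum, no entry ≡ 0) has the CM type of no
admissible triple `(a′, b′, c′)` that is neither U nor Z3 at 3 and DISJOINT from it modulo `3n` (under THEOREM KR6): after
`RowsFinal.normalise` the triple is Z1 at 3 with its 3-divisible entry `3y` in front, and `three_shared` makes `3y` congruent
to an entry of the Z3 triple. -/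
lemma no_Z3_at_three (hKR : KR6') {n a₀ b₀ c₀ a' b' c' : ℕ} (hsq : Squarefree n) (h3n : ¬ 3 ∣ n) (hodd : Odd n)
    (hs : 3 * n ∣ 3 * a₀ + 3 * b₀ + 3 * c₀) (ha : ¬ 3 * n ∣ 3 * a₀) (hb : ¬ 3 * n ∣ 3 * b₀) (hc : ¬ 3 * n ∣ 3 * c₀)
    (hs' : 3 * n ∣ a' + b' + c') (ha' : ¬ 3 * n ∣ a') (hb' : ¬ 3 * n ∣ b') (hc' : ¬ 3 * n ∣ c')
    (hnz : ¬ (3 ∣ a' ∧ 3 ∣ b' ∧ 3 ∣ c')) (hnu : ¬ (¬ 3 ∣ a' ∧ ¬ 3 ∣ b' ∧ ¬ 3 ∣ c'))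
    (hD : ∀ u v, (u = 3 * a₀ ∨ u = 3 * b₀ ∨ u = 3 * c₀) → (v = a' ∨ v = b' ∨ v = c') → ¬ u ≡ v [MOD 3 * n])
    (hH : SameType (3 * n) (3 * a₀, 3 * b₀, 3 * c₀) (a', b', c')) : False := by
  have hn : 0 < n := hodd.pos
  have hN : 0 < 3 * n := by omega
  obtain ⟨a₂, b₂, c₂, hperm, hS, hs₂, ha₂, -, -, hz₂, hp₂⟩ :=
    normalise (p := 3) hN (dvd_mul_right 3 n) hs' ha' hb' hc'
  have hmem : a₂ = a' ∨ a₂ = b' ∨ a₂ = c' := by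
    rcases hperm with h | h | h
    exacts [Or.inl h.1, Or.inr (Or.inl h.1), Or.inr (Or.inr h.1)]
  have hH₂ : SameType (3 * n) (3 * a₀, 3 * b₀, 3 * c₀) (a₂, b₂, c₂) := st_trans hH (st_symm hS)
  rcases hp₂ with hU | hZ1 | hZ3
  · rcases hperm with ⟨h1, h2, h3⟩ | ⟨h1, h2, h3⟩ | ⟨h1, h2, h3⟩
    · exact hnu ⟨h1 ▸ hU.1, h2 ▸ hU.2.1, h3 ▸ hU.2.2⟩
    · exact hnu ⟨h2 ▸ hU.2.1, h1 ▸ hU.1, h3 ▸ hU.2.2⟩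
    · exact hnu ⟨h2 ▸ hU.2.1, h3 ▸ hU.2.2, h1 ▸ hU.1⟩
  · obtain ⟨⟨y, hy2⟩, hb₂3, hc₂3⟩ := hZ1
    have hsT : n ∣ a₀ + b₀ + c₀ := by
      rw [show 3 * a₀ + 3 * b₀ + 3 * c₀ = 3 * (a₀ + b₀ + c₀) by ring] at hs
      exact Nat.dvd_of_mul_dvd_mul_left (by norm_num) hs
    have ha₀ : ¬ n ∣ a₀ := fun h => ha (Nat.mul_dvd_mul_left 3 h)
    have hb₀ : ¬ n ∣ b₀ := fun h => hb (Nat.mul_dvd_mul_left 3 h)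
    have hc₀ : ¬ n ∣ c₀ := fun h => hc (Nat.mul_dvd_mul_left 3 h)
    have hyn : ¬ n ∣ y := fun h => ha₂ (by rw [hy2]; exact Nat.mul_dvd_mul_left 3 h)
    rw [hy2] at hs₂ hH₂
    have key := three_shared hKR n a₀ b₀ c₀ y b₂ c₂ hsq hodd h3n hsT ha₀ hb₀ hc₀ hs₂ hb₂3 hc₂3 hyn hH₂
    rcases key with h | h | h
    · exact hD (3 * a₀) a₂ (Or.inl rfl) hmem (by rw [hy2]; exact (Nat.ModEq.mul_left' 3 h).symm)
    · exact hD (3 * b₀) a₂ (Or.inr (Or.inl rfl)) hmem (by rw [hy2]; exact (Nat.ModEq.mul_left' 3 h).symm)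
    · exact hD (3 * c₀) a₂ (Or.inr (Or.inr rfl)) hmem (by rw [hy2]; exact (Nat.ModEq.mul_left' 3 h).symm)
  · exact hnz (hz₂ 3 hZ3.1 hZ3.2.1 hZ3.2.2)

/-- **COROLLARY M IN FINAL FORM, generation 30, HF-G30b** (hypotheses THEOREM KR6 `KR6'` and THEOREM U⁺ `ThmUPlus'` only): for a
DISJOINT JOINTLY PRIMITIVE coincidence of CM types `(a, b, c) ∼ (a′, b′, c′)` at a squarefree odd level `m` — `3 ∣ m`; every
prime `q ≥ 7` of `m` divides no entry; every entry `x` has `gcd(x, m) ∣ 15`; if `5 ∤ m` and all entries are prime to `3`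
then `m ∈ {21, 39}`; if `5 ∣ m`, neither triple is Z3 at 5; and if `m ≠ 21`, NEITHER TRIPLE IS Z3 AT 3 (generation 30, HF-G30b:
`FiveFinal.corollaryM_final` only excluded the pattern (Z3, U) at 3; the pattern (Z3, Z1) is excluded by forced sharing,
`ThreeShared.three_shared`, and (Z3, Z3) by joint primitivity). -/
theorem corollaryM_final (hKR : KR6') (hUplus : ThmUPlus') (m a b c a' b' c' : ℕ)
    (hsq : Squarefree m) (hodd : Odd m)
    (hs : m ∣ a + b + c) (ha : ¬ m ∣ a) (hb : ¬ m ∣ b) (hc : ¬ m ∣ c)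
    (hs' : m ∣ a' + b' + c') (ha' : ¬ m ∣ a') (hb' : ¬ m ∣ b') (hc' : ¬ m ∣ c')
    (hJ : ∀ q, Nat.Prime q → q ∣ m → q ∣ a → q ∣ b → q ∣ c → q ∣ a' → q ∣ b' → q ∣ c' → False)
    (hD : ∀ u v, (u = a ∨ u = b ∨ u = c) → (v = a' ∨ v = b' ∨ v = c') → ¬ u ≡ v [MOD m])
    (hH : SameType m (a, b, c) (a', b', c')) :
    3 ∣ m ∧
    (∀ q, Nat.Prime q → 7 ≤ q → q ∣ m → ¬ q ∣ a ∧ ¬ q ∣ b ∧ ¬ q ∣ c ∧ ¬ q ∣ a' ∧ ¬ q ∣ b' ∧ ¬ q ∣ c') ∧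
    (∀ x, (x = a ∨ x = b ∨ x = c ∨ x = a' ∨ x = b' ∨ x = c') → Nat.gcd x m ∣ 15) ∧
    (¬ 5 ∣ m → (¬ 3 ∣ a ∧ ¬ 3 ∣ b ∧ ¬ 3 ∣ c ∧ ¬ 3 ∣ a' ∧ ¬ 3 ∣ b' ∧ ¬ 3 ∣ c') → m = 21 ∨ m = 39) ∧
    (5 ∣ m → ¬ (5 ∣ a ∧ 5 ∣ b ∧ 5 ∣ c) ∧ ¬ (5 ∣ a' ∧ 5 ∣ b' ∧ 5 ∣ c')) ∧
    (m ≠ 21 → ¬ (3 ∣ a ∧ 3 ∣ b ∧ 3 ∣ c) ∧ ¬ (3 ∣ a' ∧ 3 ∣ b' ∧ 3 ∣ c')) := by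
  obtain ⟨h3, h₁, h₂, h₄, h₅, h₆⟩ := FiveFinal.corollaryM_final hKR hUplus m a b c a' b' c' hsq hodd
    hs ha hb hc hs' ha' hb' hc' hJ hD hH
  refine ⟨h3, h₁, h₂, h₄, h₅, fun hm => ?_⟩
  obtain ⟨h6a, h6b⟩ := h₆ hm
  obtain ⟨n, rfl⟩ := h3
  have h3n : ¬ 3 ∣ n := fun h =>
    (by norm_num : (3:ℕ) ≠ 1) (Nat.isUnit_iff.mp (hsq 3 (Nat.mul_dvd_mul_left 3 h)))
  have hoddn : Odd n := (Nat.odd_mul.mp hodd).2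
  have hsqn : Squarefree n := hsq.of_mul_right
  refine ⟨fun hZ => ?_, fun hZ' => ?_⟩
  · obtain ⟨⟨a₀, rfl⟩, ⟨b₀, rfl⟩, ⟨c₀, rfl⟩⟩ := hZ
    exact no_Z3_at_three hKR hsqn h3n hoddn hs ha hb hc hs' ha' hb' hc'
      (fun h => hJ 3 Nat.prime_three (dvd_mul_right 3 n) (dvd_mul_right 3 a₀) (dvd_mul_right 3 b₀)
        (dvd_mul_right 3 c₀) h.1 h.2.1 h.2.2)
      (fun h => h6a ⟨dvd_mul_right 3 a₀, dvd_mul_right 3 b₀, dvd_mul_right 3 c₀, h.1, h.2.1, h.2.2⟩) hD hH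
  · obtain ⟨⟨a₀, rfl⟩, ⟨b₀, rfl⟩, ⟨c₀, rfl⟩⟩ := hZ'
    exact no_Z3_at_three hKR hsqn h3n hoddn hs' ha' hb' hc' hs ha hb hc
      (fun h => hJ 3 Nat.prime_three (dvd_mul_right 3 n) h.1 h.2.1 h.2.2 (dvd_mul_right 3 a₀) (dvd_mul_right 3 b₀)
        (dvd_mul_right 3 c₀))
      (fun h => h6b ⟨dvd_mul_right 3 a₀, dvd_mul_right 3 b₀, dvd_mul_right 3 c₀, h.1, h.2.1, h.2.2⟩)
      (fun u v hu hv h => hD v u hv hu h.symm) (st_symm hH)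

end HodgeFermat.KRFree.ThreeFinal
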